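import Literature.Computability.AlgebraicComplexity.MumfordStabilityOfSmoothForms
import Literature.Computability.AlgebraicComplexity.BI17Thm23PeriodCorrected
import Literature.Computability.AlgebraicComplexity.BI17FormsGenericNonNormalityProofs
import Literature.Computability.AlgebraicComplexity.BI17QuadraticPolystableProofs
import Literature.Computability.AlgebraicComplexity.BI17GenericDegreeMonoidProofs
import HarnessLib

/-!
# The generic degree period: `E(D,m)` generates `b(D,m)ℤ`, `b(D,m) = a'(D,m) · m / gcd(D,m)`
# (Bürgisser–Ikenmeyer 2017, Def. 3.1 and Thm. 3.4 at the generic form — PROVED, every `D ≥ 3`, `m ≥ 1`)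

P. Bürgisser, C. Ikenmeyer, *Fundamental invariants of orbit closures*, J. Algebra **477** (2017)
390–434 = arXiv:1511.02927 [BurgisserIkenmeyer2017]: Def. 3.1 (TeX L719: "`b(w) := (m/D) a(w)`",
"`b(w) = a'(w) m / gcd(D,m)`"), Thm. 3.4 (L784: "`E(w)` generates the group `b(w)ℤ`" for polystable
`w ≠ 0`), and §3.1 after Def. 3.6 (L813: "`E(w) = E(D,m)` … for almost all `w`"). THEOREMS ONLY
(cell `val-lit`, row BI2017-A; no definition, no named fact). This file assembles, now that the
cell's tree holds Thm. 2.3 as corrected (`BI2017_thm_2_3_period_corrected`: `a'(D,m) = 1` except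
`a'(3,2) = a'(3,3) = 2`), Prop. 2.10 (`BI2017_prop_2_10_holds`, Mumford route), Thm. 3.4
(`BI2017_thm_3_4_holds`) and the generic degree monoid (`BI2017_degreeMonoid_generic_holds`), the
GENERIC form of Thm. 3.4:

* `degreePeriod_eq_reducedStabilizerPeriod_mul_div_gcd` — Def. 3.1's identity
  **`b(w) = a'(w) · m / gcd(D,m)`** for every form of degree `D ≥ 1` (Lemma 2.1 + eq. (3.1)).
* **`closure_genericDegreeMonoid_eq_zmultiples`** — for `D ≥ 3`, `m ≥ 1`: the subgroup of `ℤ`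
  generated by `E(D,m)` is `b(D,m)ℤ` with `b(D,m) = a'(D,m) · m / gcd(D,m)`,
  `a'(D,m) = 2` for `(D,m) ∈ {(3,2),(3,3)}` and `1` otherwise.
* `exists_consecutive_mem_genericDegreeMonoid` — for `D ≥ 3`, `m ≥ 1`, `(D,m) ∉ {(3,2),(3,3)}`:
  `E(D,m)` contains `(m/g) t` and `(m/g)(t+1)` for some `t` (`g = gcd(D,m)`); i.e. the
  "two invariant degrees" hypothesis of `isZariskiGeneric_period_of_invariants` /
  `isZariskiGeneric_not_isIntegrallyClosed_of_invariants` (`BI17FormsGenericNonNormalityProofs.lean`)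
  is ALWAYS met on that range (so that reduction and Thm. 2.3 corrected are equivalent in content).

Honest framing: bookkeeping assembly of published results already discharged in the tree (cell
`val-lit`, LADDER-VALIANT V3); nothing here bears on VP versus VNP.

## References

* [BurgisserIkenmeyer2017] Def. 3.1 (L719), eq. (3.1) (L764), Thm. 3.4 (L784), §3.1 (L813),
  Thm. 2.3 (L473), Prop. 2.10 (L633).
-/

noncomputable section

open MvPolynomial

namespace Literature.Computability.AlgebraicComplexity

section GenericDegreePeriod

variable {m D : ℕ}

/-- **BI 2017, Def. 3.1: `b(w) = a'(w) · m / gcd(D,m)`** for every form `w` of degree `D ≥ 1` in `m`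
variables (from Lemma 2.1, `a(w) = (D/g) a'(w)`, and eq. (3.1), `D b(w) = m a(w)`).
[cite: BurgisserIkenmeyer2017, Def. 3.1] -/
theorem degreePeriod_eq_reducedStabilizerPeriod_mul_div_gcd {f : MvPolynomial (Fin m) ℂ}
    (hD : 0 < D) (hf : f.IsHomogeneous D) :
    degreePeriod D f = reducedStabilizerPeriod D f * (m / Nat.gcd D m) := by
  set g := Nat.gcd D m with hg
  have hg0 : 0 < g := Nat.gcd_pos_of_pos_left _ hD
  have hgD : g ∣ D := Nat.gcd_dvd_left D m
  have hgm : g ∣ m := Nat.gcd_dvd_right D m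
  obtain ⟨c, hc⟩ := BI2017_lem_2_1 hf hD
  -- `a(w) g = D c`, so `a'(w) = c`
  have hag : stabilizerPeriod f * g = D * c := by
    rw [hc, mul_comm (D / g) c, mul_assoc, Nat.div_mul_cancel hgD, mul_comm]
  have ha' : reducedStabilizerPeriod D f = c := by
    rw [reducedStabilizerPeriod, Fintype.card_fin, ← hg, hag, Nat.mul_div_cancel_left _ hD]
  -- `D b = m a = m (D/g) c = D ((m/g) c)`
  have h31 := BI2017_eq_3_1 hf hD
  rw [hc] at h31
  have hm' : m * (D / g * c) = D * (c * (m / g)) := by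
    have h1 : m * (D / g) = D * (m / g) := by
      rw [← Nat.mul_div_assoc m hgD, ← Nat.mul_div_assoc D hgm, mul_comm]
    rw [← mul_assoc, h1, mul_assoc, mul_comm (m / g) c]
  rw [hm'] at h31
  rw [ha']
  exact Nat.eq_of_mul_eq_mul_left hD h31

/-- **The generic degree period `b(D,m)`: `E(D,m)` generates `b(D,m)ℤ`,
`b(D,m) = a'(D,m) · m / gcd(D,m)`** (`D ≥ 3`, `m ≥ 1`; `a'(D,m) = 2` exactly for `(D,m) ∈ {(3,2),(3,3)}`,
else `1`) — BI Thm. 3.4 at a generic form `w` (polystable by Prop. 2.10, `a'(w) = a'(D,m)` by Thm. 2.3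
as corrected, `E(w) = E(D,m)` by §3.1), all four inputs being theorems of the tree.
[cite: BurgisserIkenmeyer2017, Thm. 3.4] -/
theorem closure_genericDegreeMonoid_eq_zmultiples (hD : 2 < D) (hm : 1 ≤ m) :
    AddSubgroup.closure ((fun d : ℕ => (d : ℤ)) '' genericDegreeMonoid (Fin m) ℂ D) =
      AddSubgroup.zmultiples
        ((((if (D = 3 ∧ m = 2) ∨ (D = 3 ∧ m = 3) then 2 else 1) * (m / Nat.gcd D m) : ℕ) : ℤ)) := by
  have hD0 : 0 < D := by omega
  have hgen := ((BI2017_thm_2_3_period_corrected D m hD hm).and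
    (BI2017_prop_2_10_holds D m (by omega))).and
    ((isZariskiGeneric_ne_zero (by omega) D).and (BI2017_degreeMonoid_generic_holds D m))
  obtain ⟨f, hf, ⟨ha', hpoly⟩, hf0, hE, -⟩ := hgen.exists_form
  rw [← hE, BI2017_thm_3_4_holds m D f (by omega) hf hf0 hpoly,
    degreePeriod_eq_reducedStabilizerPeriod_mul_div_gcd hD0 hf, ha']

/-- **Two consecutive reduced invariant degrees always exist** (`D ≥ 3`, `m ≥ 1`,
`(D,m) ∉ {(3,2),(3,3)}`): `E(D,m) ∋ (m/g) t, (m/g)(t+1)` for some `t`, `g = gcd(D,m)` — the hypothesis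
of this seat's witness-free reduction (`isZariskiGeneric_period_of_invariants`,
`isZariskiGeneric_not_isIntegrallyClosed_of_invariants`) is met on the whole corrected range of
Thm. 2.3. (A generic `w` has `b(w) = m/g`; Thm. 3.4 gives `q, q + b(w) ∈ E(w) = E(D,m)` with `b(w) ∣ q`.)
[cite: BurgisserIkenmeyer2017, Thm. 3.4] -/
theorem exists_consecutive_mem_genericDegreeMonoid (hD : 2 < D) (hm : 1 ≤ m)
    (hexc : ¬ (D = 3 ∧ (m = 2 ∨ m = 3))) :
    ∃ t : ℕ, m / Nat.gcd D m * t ∈ genericDegreeMonoid (Fin m) ℂ D ∧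
      m / Nat.gcd D m * (t + 1) ∈ genericDegreeMonoid (Fin m) ℂ D := by
  have hD0 : 0 < D := by omega
  have hgen := ((BI2017_thm_2_3_period_corrected_eq_one hD hm hexc).and
    (BI2017_prop_2_10_holds D m (by omega))).and
    ((isZariskiGeneric_ne_zero (by omega) D).and (BI2017_degreeMonoid_generic_holds D m))
  obtain ⟨f, hf, ⟨ha', hpoly⟩, hf0, hE, -⟩ := hgen.exists_form
  have hb : degreePeriod D f = m / Nat.gcd D m :=
    degreePeriod_eq_div_gcd_of_reducedStabilizerPeriod_eq_one hD0 hf ha'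
  obtain ⟨q, hq, hqb⟩ := exists_mem_degreeMonoid_add_degreePeriod (by omega) hf hf0 hpoly
  obtain ⟨t, ht⟩ := degreePeriod_dvd_of_mem_degreeMonoid (by omega) hf hf0 hpoly hq
  refine ⟨t, ?_, ?_⟩
  · rw [← hE, ← hb, ← ht]
    exact hq
  · rw [← hE, ← hb, mul_add, mul_one, ← ht]
    exact hqb

/-- **Corollary: the generic degree monoid is never trivial** (`D ≥ 3`, `m ≥ 1`): `E(D,m)` has a
positive element (Hilbert's nonvanishing, here through Thm. 3.4 at a generic polystable form).
[cite: BurgisserIkenmeyer2017, Thm. 3.4] -/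
theorem exists_pos_mem_genericDegreeMonoid (hD : 2 < D) (hm : 1 ≤ m) :
    ∃ d : ℕ, 0 < d ∧ d ∈ genericDegreeMonoid (Fin m) ℂ D := by
  have hD0 : 0 < D := by omega
  have hgen := (BI2017_prop_2_10_holds D m (by omega)).and
    ((isZariskiGeneric_ne_zero (by omega) D).and (BI2017_degreeMonoid_generic_holds D m))
  obtain ⟨f, hf, hpoly, hf0, hE, -⟩ := hgen.exists_form
  obtain ⟨q, -, hqb⟩ := exists_mem_degreeMonoid_add_degreePeriod (by omega) hf hf0 hpoly
  have hb0 : 0 < degreePeriod D f := by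
    have h31 := BI2017_eq_3_1 hf hD0
    have ha0 : 0 < stabilizerPeriod f :=
      Nat.pos_of_ne_zero (BI2017_prop_2_11_holds m D f hD0 hf hf0 hpoly)
    rcases Nat.eq_zero_or_pos (degreePeriod D f) with h0 | h0
    · rw [h0, mul_zero] at h31
      exact absurd h31.symm (Nat.mul_ne_zero (by omega) ha0.ne')
    · exact h0
  exact ⟨q + degreePeriod D f, by omega, hE ▸ hqb⟩

end GenericDegreePeriod

end Literature.Computability.AlgebraicComplexity

end
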